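import Summits.ValiantsHypothesis.ValiantsHypothesis.Theorems.DepthWindowNodeBiasLaw
import Summits.ValiantsHypothesis.ValiantsHypothesis.Theorems.DepthWindowBDSBound
import HarnessLib.Audit.Tags

/-!
# Route `DepthWindow` — the Bhargav–Dutta–Saxena word has a HIGH-BIAS NODE in every tree (fixed parameters)

Cone-free helper (decomp-valiant workshop, lens 4 «depth-reduction / chasm axis», generation 14) supporting the
crux item `HomImmHardTwoOne` (stmt-ValiantsHypothesis-30635).  It runs the descent lemma
`TreeBias.exists_nodeBias_ge_of_law` (`DepthWindowNodeBiasLaw.lean`) on the depth-tuned two-letter word of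
[BhargavDuttaSaxena2024, §4.1] EXACTLY as the relative-rank bound `BDS.homBds` (`DepthWindowBDSBound.lean`, g10)
runs the flat-rank induction: same parameter bundle `exists_params` (continued-fraction thresholds `θ_0 = 3/2`,
`θ_{m+1} = b_{m+1}/2`, rates `κ_0 = (q-p)t`, `κ_{m+1} = t c_m/(2 b_m)`), same laws `law_level_zero/succ`, same
steps `step_level_zero/succ` (read linearly: `κ_p θ_{p+1} ≥ qtλ/32`).  Result, for every depth `Δ ≥ 1`, every
`λ ≥ 3` and every `d` with `λ^{F_{Δ+2}} ≤ λ d` (the fit of [BhargavDuttaSaxena2024, Lemma 4.3]; `λ ≈ d^{μ(Δ)}`,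
`μ(Δ) = 1/(F_{Δ+2} - 1)`):

* `exists_word_nodeBias_ge` : there are `1 ≤ p < q ≤ 2d` such that for EVERY scale `t` the greedy word with letters
  `+(q-p)t`, `-qt` on `d` positions (all prefix overhangs, letters and total bounded by `h = qt`) has, in EVERY
  levelled tree whose level `Δ` is a single block, a node of node bias `≥ h·λ/32`;
* `not_lowBiasTree_bds` : hence no depth-`Δ` tree of node bias `≤ β` exists for that word when `β < h λ/32`.

So the node bias forced by two letters at depth `Δ` grows like `h·d^{μ(Δ)}` — the ADVERSARY's match to the
builder's rungs of g13 (`ULB_∞`: node bias `4h` at depth `⌈log₂ d⌉`, kernel), and the input of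
`DepthWindowTreeBiasGrowthOne.lean` (`TreeBiasGrowthAt 1`, `¬ UniversalLowBiasAt 1`).  Unconditional, 0 sorry,
definition-free; rung currency only — nothing here bears on `VP ≠ VNP` itself.

References: [BhargavDuttaSaxena2024] ACM ToCT 16(4):23 (2024) §4.1, Lemma 4.1, Lemma 4.3 (= MFCS 2022, LIPIcs
241:18, App. A); [LimayeSrinivasanTavenas2025] J. ACM 72 (2025) Art. 26, Lemma 15, Claim 16;
[LimayeSrinivasanTavenas2022] ECCC TR22-090 Def. 15, Prop. 17.
-/

-- layout Summits/ValiantsHypothesis/ValiantsHypothesis forces the duplicated namespace component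
set_option linter.dupNamespace false

namespace Summit.ValiantsHypothesis.ValiantsHypothesis.Theorems.DepthWindow.BDS

open Finset Literature.Computability.AlgebraicComplexity
open Literature.Computability.AlgebraicComplexity.GenWord
open Summit.ValiantsHypothesis.ValiantsHypothesis.Theorems.DepthWindow.TreeBias

noncomputable section

/-! ### Small facts about the two-letter word -/

/-- The letters of the two-letter word are bounded by the larger size. [folklore] -/
theorem abs_wt_letterSize₂_le {d : ℕ} (kp kn : ℕ) (hk : kp ≤ kn) (pos : Fin d → Bool) (i : Fin d) :
    |wt (letterSize₂ kp kn pos) pos i| ≤ (kn : ℤ) := by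
  unfold wt letterSize₂
  cases pos i
  · simp
  · simpa using (show (kp : ℤ) ≤ kn by exact_mod_cast hk)

/-- A word whose full overhang is `≤ K` has total `|Σ w_i| ≤ K`. [cite: LimayeSrinivasanTavenas2025, Lemma 22] -/
theorem abs_sum_wt_le_of_overLen {d : ℕ} (sz : Fin d → ℕ) (pos : Fin d → Bool) {K : ℕ}
    (h : overLen sz pos d ≤ K) : |∑ i, wt sz pos i| ≤ (K : ℤ) := by
  rw [overLen_eq_natAbs sz pos d le_rfl, filter_true_of_mem (fun j _ => j.isLt)] at h
  unfold wsum at h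
  rw [Int.abs_eq_natAbs]
  exact_mod_cast h

/-- A step inequality of the engine, read linearly: `2^{-x/2} ≤ 2^{-y/64}` gives `y/32 ≤ x`. [folklore] -/
theorem div_le_of_rpow_step {x y : ℝ} (h : (2 : ℝ) ^ (-x / 2) ≤ (2 : ℝ) ^ (-y / 64)) : y / 32 ≤ x := by
  have h1 := (Real.rpow_le_rpow_left_iff (by norm_num : (1 : ℝ) < 2)).1 h
  linarith

/-! ### The high-bias node of the BDS word -/

/-- **The BDS word forces a high-bias node, at fixed parameters.**  For `Δ ≥ 1`, `λ ≥ 3` and `λ^{F_{Δ+2}} ≤ λ d`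
there are `1 ≤ p < q ≤ 2d` (the continued-fraction parameters of [BhargavDuttaSaxena2024, §4.1]) such that for
every scale `t`, the greedy two-letter word with letters `+(q-p)t`, `-qt` on `d` positions has all prefix
overhangs, all letters and its total bounded by `qt`, and EVERY levelled tree whose level `Δ` is a single block
has a node at a level `1 ≤ u ≤ Δ` of node bias `≥ qt·λ/32`.  (`λ ≥ 3` only keeps the level-one threshold
`b_1/2 = λ/2` above `1`; the engine `homBds` asks `λ ≥ 32`.) [cite: BhargavDuttaSaxena2024, Lemma 4.3]
[cite: LimayeSrinivasanTavenas2022, Def. 15] -/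
theorem exists_word_nodeBias_ge {Δ : ℕ} (hΔ : 1 ≤ Δ) {d lam : ℕ} (hlam : 3 ≤ lam)
    (hfit : lam ^ Nat.fib (Δ + 2) ≤ lam * d) :
    ∃ p q : ℕ, 1 ≤ p ∧ p < q ∧ q ≤ 2 * d ∧ ∀ t : ℕ,
      (∀ t', overLen (letterSize₂ ((q - p) * t) (q * t) (greedyWord₂ d ((q - p) * t) (q * t)))
          (greedyWord₂ d ((q - p) * t) (q * t)) t' ≤ q * t) ∧
      (∀ i, |wt (letterSize₂ ((q - p) * t) (q * t) (greedyWord₂ d ((q - p) * t) (q * t)))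
          (greedyWord₂ d ((q - p) * t) (q * t)) i| ≤ ((q * t : ℕ) : ℤ)) ∧
      |∑ i, wt (letterSize₂ ((q - p) * t) (q * t) (greedyWord₂ d ((q - p) * t) (q * t)))
          (greedyWord₂ d ((q - p) * t) (q * t)) i| ≤ ((q * t : ℕ) : ℤ) ∧
      ∀ T : LTree d, (∀ i j, T.lab Δ i = T.lab Δ j) →
        ∃ u : ℕ, ∃ i : Fin d, 1 ≤ u ∧ u ≤ Δ ∧
          ((q * t : ℕ) : ℝ) * lam / 32 ≤
            ((nodeBias (wt (letterSize₂ ((q - p) * t) (q * t) (greedyWord₂ d ((q - p) * t) (q * t)))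
              (greedyWord₂ d ((q - p) * t) (q * t))) T u i : ℤ) : ℝ) := by
  obtain ⟨Δ, rfl⟩ : ∃ Δ', Δ = Δ' + 1 := ⟨Δ - 1, by omega⟩
  obtain ⟨p, q, b, c, hb0, hb1, hbmono, hbpow, hp1, hlp, -, hq2b, -, hlaw, hstep, hbot⟩ :=
    exists_params lam Δ (by omega)
  have hlam0 : 0 < lam := by omega
  have hlam1 : 1 ≤ lam := by omega
  have hbΔ : b (Δ + 1) ≤ d := Nat.le_of_mul_le_mul_left ((hbpow (Δ + 1)).trans hfit) hlam0
  have hpq : p < q := by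
    have h2 : 2 * p ≤ lam * p := Nat.mul_le_mul_right p (by omega)
    exact lt_of_lt_of_le (by omega) (h2.trans hlp)
  have hpq' : p ≤ q := hpq.le
  have hbge : ∀ m, 1 ≤ b m := fun m => hb0 ▸ hbmono (Nat.zero_le m)
  have hbge' : ∀ m, lam ≤ b (m + 1) := fun m => hb1 ▸ hbmono (show 1 ≤ m + 1 by omega)
  rw [hb1] at hbot
  refine ⟨p, q, hp1, hpq, hq2b.trans (by omega), fun t => ?_⟩
  have hkpn : (q - p) * t ≤ q * t := Nat.mul_le_mul_right t (Nat.sub_le q p)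
  have hover : ∀ t', overLen (letterSize₂ ((q - p) * t) (q * t) (greedyWord₂ d ((q - p) * t) (q * t)))
      (greedyWord₂ d ((q - p) * t) (q * t)) t' ≤ q * t := fun t' => by
    have h := overLen_greedy_le d ((q - p) * t) (q * t) t'
    rwa [max_eq_right hkpn] at h
  -- the engine's two step inequalities at scale `t`, read linearly
  have hs0 : ((q * t : ℕ) : ℝ) * lam / 32 ≤ (((q - p) * t : ℕ) : ℝ) * ((lam : ℝ) / 2) :=
    div_le_of_rpow_step (by
      have h0 := step_level_zero t hlam1 hpq' hbot
      convert h0 using 2 <;> ring)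
  have hsS : ∀ m, m ≤ Δ →
      ((q * t : ℕ) : ℝ) * lam / 32 ≤ ((t * c m : ℕ) : ℝ) / (2 * b m) * ((b (m + 2) : ℝ) / 2) :=
    fun m hm => div_le_of_rpow_step (by
      have h0 := step_level_succ t (hbge m) (hstep m hm)
      convert h0 using 2 <;> ring)
  -- from here on only the laws matter: any word with these letter sizes would do
  generalize greedyWord₂ d ((q - p) * t) (q * t) = g at hover ⊢
  refine ⟨hover, fun i => abs_wt_letterSize₂_le _ _ hkpn g i, abs_sum_wt_le_of_overLen _ g (hover d),
    fun T hroot => ?_⟩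
  -- the descent with `θ_0 = 3/2`, `θ_{m+1} = b_{m+1}/2`, `κ_0 = (q-p)t`, `κ_{m+1} = t c_m/(2 b_m)`, `E = qtλ/32`
  exact exists_nodeBias_ge_of_law _ (Δ := Δ + 1) (by omega)
    (θ := fun i => if i = 0 then 3 / 2 else (b i : ℝ) / 2)
    (κ := fun i => if i = 0 then (((q - p) * t : ℕ) : ℝ) else ((t * c (i - 1) : ℕ) : ℝ) / (2 * b (i - 1)))
    (E := ((q * t : ℕ) : ℝ) * lam / 32)
    (fun i => by
      rcases i with _ | m
      · rw [if_pos rfl]; norm_num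
      · rw [if_neg (Nat.succ_ne_zero m)]
        have h2 : (3 : ℝ) ≤ b (m + 1) := by exact_mod_cast hlam.trans (hbge' m)
        linarith)
    (fun i hi W hW => by
      rcases i with _ | m
      · rw [if_pos rfl] at hW ⊢
        exact law_level_zero _ _ hkpn g W hW
      · rw [if_neg (Nat.succ_ne_zero m)] at hW ⊢
        simp only [Nat.add_sub_cancel]
        exact law_level_succ t hpq' (hbge m) (hlaw m (by omega)) g W hW)
    (fun i hi => by split_ifs <;> positivity)
    (fun i hi => by
      rcases i with _ | m
      · rw [if_pos rfl, if_neg (Nat.succ_ne_zero 0), hb1]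
        exact hs0
      · rw [if_neg (Nat.succ_ne_zero m), if_neg (Nat.succ_ne_zero (m + 1))]
        simp only [Nat.add_sub_cancel]
        exact hsS m (by omega))
    (by
      rw [if_neg (Nat.succ_ne_zero Δ)]
      have h1 : (b (Δ + 1) : ℝ) ≤ d := by exact_mod_cast hbΔ
      have h2 : (0 : ℝ) ≤ b (Δ + 1) := Nat.cast_nonneg _
      linarith)
    T hroot

/-- **No low-bias tree for the BDS word**: with `p, q` as in `exists_word_nodeBias_ge`, for every scale `t` and
every `β < qt·λ/32` the word has NO depth-`Δ` tree of node bias `≤ β` — the adversary's rung, to be compared with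
the builder's `lowBiasTree_clog_of_bounded` (node bias `4·qt` at depth `⌈log₂ d⌉`, g13).
[cite: BhargavDuttaSaxena2024, Lemma 4.3] [cite: LimayeSrinivasanTavenas2022, Prop. 17] -/
theorem not_lowBiasTree_bds {Δ : ℕ} (hΔ : 1 ≤ Δ) {d lam : ℕ} (hlam : 3 ≤ lam)
    (hfit : lam ^ Nat.fib (Δ + 2) ≤ lam * d) :
    ∃ p q : ℕ, 1 ≤ p ∧ p < q ∧ q ≤ 2 * d ∧ ∀ t : ℕ, ∀ β : ℤ, (β : ℝ) < ((q * t : ℕ) : ℝ) * lam / 32 →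
      ¬ LowBiasTree (wt (letterSize₂ ((q - p) * t) (q * t) (greedyWord₂ d ((q - p) * t) (q * t)))
          (greedyWord₂ d ((q - p) * t) (q * t))) Δ β := by
  obtain ⟨p, q, hp1, hpq, hqd, hw⟩ := exists_word_nodeBias_ge hΔ hlam hfit
  refine ⟨p, q, hp1, hpq, hqd, fun t β hβ => ?_⟩
  rintro ⟨T, hroot, hle⟩
  obtain ⟨-, -, -, hT⟩ := hw t
  obtain ⟨u, i, hu1, huΔ, hE⟩ := hT T hroot
  exact (not_lt.2 hE) (lt_of_le_of_lt (by exact_mod_cast hle u hu1 huΔ i) hβ)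

end

end Summit.ValiantsHypothesis.ValiantsHypothesis.Theorems.DepthWindow.BDS
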